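/-
Copyright (c) 2026 the pub-hodgecm-mathlib formalisation cell (harness21).  Prover seat hodgecm-mathlib-F0P3a-p05 (g17): road «S3-ram» (LEAD F0P3a-plan (g12∕g13); owner∕table
F0P3a-p06 (g15)), the (a2) JUNCTION (J★): «FRAMES OF THE FOUR LITERALS + CLASS CONSTANT MODULO UNIT SQUARES» (A-p16 (g32) 01:34:50Z «(ii) frames: yes please, as a ★ lemma»
for the head's last mile `signedStrataCount_typeOne_ram_of_strataCounts`); 2026-09-02.
-/
import Literature.NumberTheory.Automorphic.UnitaryLatticeTreeIsTreeDiagonalRamified   -- ★ J1 p847380 (F0P2-p02 (g13)): `exists_glInt_diagonal_eq_smul_formCongr_antidiagonal` (the integral antidiagonal frame of a diagonal unit form)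
import HarnessLib

/-!
# The lattice graph of a hermitian space — THE FOUR RAMIFIED TYPE-(1) LITERALS' DIAGONAL DATA `d_b = (ε^{b₁}u₀, ε^{b₂}u₁, ε^{b₁+b₂}u₂)`: unit `σ`-fixed entries, determinant
# `ε^{2(b₁+b₂)}u₀u₁u₂`, integral antidiagonal frame, and the class constant read modulo unit squares (Rogawski 1990 §4.9; Kottwitz 1986 §3; Jacobowitz 1962 §8)

Topic `NumberTheory/Automorphic`; namespace `Literature.NumberTheory.Automorphic.UnitaryLatticeTree`.  THEOREMS ONLY (no definition, no instance, no notation, no named fact,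
no `sorry`); kernel lane `--supports stmt-HodgeConjecture-24833`; datum-free where possible (§1 any `K` with `Valued K ℤᵐ⁰`; the determinant∕constant identities over any
commutative ring ∕ field).  Cell `pub/hodgecm-mathlib` (D-0151), crux H413; road «S3-ram» (Literature seeding, count-neutral), organ A′e, the JUNCTION (J★)
`stub_signedStrataCount_typeOne_ram` (F0P3a-p01 (g16∕g17); sf v3 04fe0ed2): the head sums over the four literals `b ∈ Fin 2 × Fin 2`, each counted for the DIAGONAL form
`diag d_b`, `d_b = (ε^{b₁}u₀, ε^{b₂}u₁, ε^{b₁+b₂}u₂)` (`u₀ u₁ u₂ ε` `σ`-fixed integral units, `ε` residually a non-square), with ONE class constant `c₀`.  The per-literal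
J₀-statements of the junction (skeleton v4∕v5: `strataCount_J₀_equilateral`, the iso mains; ★ p847541 D-head transport; ★ p847564 J₀-element; ★ p847574 Fix-finite; ★ p847587
ROW-REG-eq) all take the feed `(d) (hd : ∀ i, |d i| = 1) (hdσ : ∀ i, σ (d i) = d i) (A) (hA hA' : A, A⁻¹ integral) (hdA : diag d = (−det diag d) • ᵗσ(A) J₀ A)` and a J₀-side
constant `c₁` with `c₀ = (−det diag d)·c₁`.  THIS FILE packages that feed for `d := d_b` (A-p16 (g32) 2026-09-02T01:34:50Z, for the head's last mile
`signedStrataCount_typeOne_ram_of_strataCounts`): §2 `exists_frame_literalDiag` (★ J1 at `d_b`), `det_diagonal_literalDiag` (`det diag d_b = (ε^{b₁+b₂})²·u₀u₁u₂`),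
`eq_mul_sq_of_eq_neg_det_literalDiag_mul` (`c₁ = (−c₀∕(u₀u₁u₂))·((ε^{b₁+b₂})⁻¹)²`: the four J₀-constants differ from the COMMON `−c₀∕(u₀u₁u₂)` by unit squares), and §1
`exists_mem_class_mul_sq_iff` (the `CLS` token does not see a unit-square factor of its constant) — so all four literals carry the SAME class label `cl`.
HONEST LABEL: HC_CM is proved only modulo the 2 remaining named inputs (hLiu418 24832, h413 24833) until rung 0 closes; nothing printed is asserted here (bookkeeping).

* §1 **`exists_mem_class_mul_sq_iff`**.
* §2 `v_literalDiag_eq_one`, `map_literalDiag_eq`, `det_diagonal_literalDiag`, **`eq_mul_sq_of_eq_neg_det_literalDiag_mul`**, **`exists_frame_literalDiag`**.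

## References
* [Rogawski1990] J. D. Rogawski, *Automorphic Representations of Unitary Groups in Three Variables*, Ann. of Math. Stud. 123 (1990), §4.9 pp. 54–55 (the four classes in the
  stable class of a type-(1) element at a ramified place and their lattice counts).
* [Kottwitz1986] R. E. Kottwitz, *Base change for unit elements of Hecke algebras*, Compositio Math. 60 (1986), §3.
* [Jacobowitz1962] R. Jacobowitz, *Hermitian forms over local fields*, Amer. J. Math. 84 (1962), §8 (unimodular hermitian lattices at a ramified prime).
* [BruhatTits1972] F. Bruhat, J. Tits, *Groupes réductifs sur un corps local I*, Publ. Math. IHÉS 41 (1972), §10.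
-/

set_option autoImplicit false

noncomputable section

open scoped Valued WithZero Matrix MatrixGroups

namespace Literature.NumberTheory.Automorphic.UnitaryLatticeTree

open Literature.NumberTheory.Automorphic Literature.NumberTheory.Automorphic.HermitianLattice

variable {K : Type*} [Field K] [Valued K ℤᵐ⁰] {N : ℕ}

/-! ## §1 The class token's constant is read modulo UNIT SQUARES -/

/-- **THE CLASS CONSTANT COUNTS MODULO UNIT SQUARES**: for `|z| = 1`, «some `y ∈ M` has `|X(y) − (c·z²)·a²| < 1` with `|a| = 1`» iff the same with constant `c`
(reparametrise `a ↦ z·a`); here `X(y) = ϖ′·B_H(y, Ay)` for any operator `A` and scalar `ϖ′`. [cite: Rogawski1990, §4.9 p. 55] [cite: Kottwitz1986, §3] -/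
theorem exists_mem_class_mul_sq_iff (σ : K →+* K) (H : Matrix (Fin N) (Fin N) K) (A : Matrix (Fin N) (Fin N) K) (ϖ' c : K) {z : K} (hz : Valued.v z = 1)
    (M : Submodule 𝒪[K] (Fin N → K)) :
    (∃ y ∈ M, ∃ a : K, Valued.v a = 1 ∧ Valued.v (ϖ' * pairing σ H y (A *ᵥ y) - c * z ^ 2 * a ^ 2) < 1) ↔
      ∃ y ∈ M, ∃ a : K, Valued.v a = 1 ∧ Valued.v (ϖ' * pairing σ H y (A *ᵥ y) - c * a ^ 2) < 1 := by
  have hz0 : z ≠ 0 := fun h => by rw [h, map_zero] at hz; exact zero_ne_one hz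
  constructor
  · rintro ⟨y, hy, a, ha, hlt⟩
    refine ⟨y, hy, z * a, by rw [map_mul, hz, ha, one_mul], ?_⟩
    rwa [mul_pow, ← mul_assoc]
  · rintro ⟨y, hy, a, ha, hlt⟩
    refine ⟨y, hy, z⁻¹ * a, by rw [map_mul, map_inv₀, hz, ha, inv_one, one_mul], ?_⟩
    rwa [mul_pow, show c * z ^ 2 * ((z⁻¹) ^ 2 * a ^ 2) = c * a ^ 2 by field_simp]

/-! ## §2 The diagonal datum `d_b = (ε^{b₁}u₀, ε^{b₂}u₁, ε^{b₁+b₂}u₂)` of the four ramified type-(1) literals: units, `σ`-fixed, determinant, class constant, integral frame -/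

section Literal

variable {σ : K →+* K} (u₀ u₁ u₂ ε : 𝒪[K]) (b : Fin 2 × Fin 2)

/-- The entries of `d_b` are units. [cite: Rogawski1990, §4.9 p. 55] -/
theorem v_literalDiag_eq_one (hu₀ : Valued.v (u₀ : K) = 1) (hu₁ : Valued.v (u₁ : K) = 1) (hu₂ : Valued.v (u₂ : K) = 1) (hεv : Valued.v (ε : K) = 1) (i : Fin 3) :
    Valued.v ((![((ε : K)) ^ (b.1 : ℕ) * (u₀ : K), (ε : K) ^ (b.2 : ℕ) * (u₁ : K), (ε : K) ^ ((b.1 : ℕ) + (b.2 : ℕ)) * (u₂ : K)] : Fin 3 → K) i) = 1 := by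
  fin_cases i <;> simp [hu₀, hu₁, hu₂, hεv]

omit [Valued K ℤᵐ⁰] in
/-- The entries of `d_b` are `σ`-fixed (for `σ`-fixed `u₀ u₁ u₂ ε`). [cite: Rogawski1990, §4.9 p. 55] -/
theorem map_literalDiag_eq {R : Type*} [CommRing R] (σ : R →+* R) (u₀ u₁ u₂ ε : R) (b : Fin 2 × Fin 2)
    (hσu₀ : σ u₀ = u₀) (hσu₁ : σ u₁ = u₁) (hσu₂ : σ u₂ = u₂) (hσε : σ ε = ε) (i : Fin 3) :
    σ ((![ε ^ (b.1 : ℕ) * u₀, ε ^ (b.2 : ℕ) * u₁, ε ^ ((b.1 : ℕ) + (b.2 : ℕ)) * u₂] : Fin 3 → R) i) =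
      (![ε ^ (b.1 : ℕ) * u₀, ε ^ (b.2 : ℕ) * u₁, ε ^ ((b.1 : ℕ) + (b.2 : ℕ)) * u₂] : Fin 3 → R) i := by
  fin_cases i <;> simp [map_mul, map_pow, hσu₀, hσu₁, hσu₂, hσε]

omit [Valued K ℤᵐ⁰] in
/-- `det diag(d_b) = ε^{2(b₁+b₂)}·u₀u₁u₂` — a unit SQUARE times the `b`-independent `u₀u₁u₂`. [cite: Rogawski1990, §4.9 p. 55] -/
theorem det_diagonal_literalDiag {R : Type*} [CommRing R] (u₀ u₁ u₂ ε : R) (b : Fin 2 × Fin 2) :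
    (Matrix.diagonal (![ε ^ (b.1 : ℕ) * u₀, ε ^ (b.2 : ℕ) * u₁, ε ^ ((b.1 : ℕ) + (b.2 : ℕ)) * u₂] : Fin 3 → R)).det =
      (ε ^ ((b.1 : ℕ) + (b.2 : ℕ))) ^ 2 * (u₀ * u₁ * u₂) := by
  rw [Matrix.det_diagonal, Fin.prod_univ_three]
  simp only [Matrix.cons_val_zero, Matrix.cons_val_one, Matrix.cons_val_two, Matrix.head_cons, Matrix.tail_cons]
  ring

omit [Valued K ℤᵐ⁰] in
/-- **THE J₀-MODEL CLASS CONSTANT OF THE LITERAL `b` IS `b`-INDEPENDENT MODULO UNIT SQUARES**: if `c₀ = (−det diag d_b)·c₁` (the D-head transport's constant, ★ p847541) and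
`u₀u₁u₂ ≠ 0`, `ε ≠ 0`, then `c₁ = (−c₀ ∕ (u₀u₁u₂)) · ((ε^{b₁+b₂})⁻¹)²` — with §1 every literal's `CLS` reads the common constant `−c₀∕(u₀u₁u₂)`. [cite: Rogawski1990, §4.9 p. 55] -/
theorem eq_mul_sq_of_eq_neg_det_literalDiag_mul {F : Type*} [Field F] (u₀ u₁ u₂ ε c₀ c₁ : F) (b : Fin 2 × Fin 2) (hu : u₀ * u₁ * u₂ ≠ 0) (hε : ε ≠ 0)
    (hc : c₀ = (-(Matrix.diagonal (![ε ^ (b.1 : ℕ) * u₀, ε ^ (b.2 : ℕ) * u₁, ε ^ ((b.1 : ℕ) + (b.2 : ℕ)) * u₂] : Fin 3 → F)).det) * c₁) :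
    c₁ = (-c₀ / (u₀ * u₁ * u₂)) * ((ε ^ ((b.1 : ℕ) + (b.2 : ℕ)))⁻¹) ^ 2 := by
  rw [det_diagonal_literalDiag] at hc
  have hp : (ε ^ ((b.1 : ℕ) + (b.2 : ℕ))) ≠ 0 := pow_ne_zero _ hε
  have h0 : u₀ ≠ 0 := fun h => hu (by rw [h, zero_mul, zero_mul])
  have h1 : u₁ ≠ 0 := fun h => hu (by rw [h, mul_zero, zero_mul])
  have h2 : u₂ ≠ 0 := fun h => hu (by rw [h, mul_zero])
  rw [hc]
  field_simp

/-- **THE INTEGRAL ANTIDIAGONAL FRAME OF THE LITERAL `b`** (★ J1 at `d_b`): units `σ`-fixed `u₀ u₁ u₂ ε` give `d_b` with unit `σ`-fixed entries and an `A_b ∈ GL₃(K)` with `A_b, A_b⁻¹`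
integral and `diag d_b = (−det diag d_b) • ᵗσ(A_b) J₀ A_b` — the `d hd hdσ A hA hA' hdA` feed of the junction's J₀-statements for the literal `b`.
[cite: Jacobowitz1962, §8] [cite: BruhatTits1972, §10] [cite: Rogawski1990, §4.9 p. 55] -/
theorem exists_frame_literalDiag [Finite 𝓀[K]] (hσ : ∀ x, σ (σ x) = x) (hvσ : ∀ a, Valued.v (σ a) = Valued.v a)
    (hres : ∀ x : K, Valued.v x ≤ 1 → Valued.v (σ x - x) < 1) (h2 : Valued.v (2 : K) = 1)
    (hnorm : ∀ u : K, σ u = u → Valued.v (u - 1) < 1 → ∃ z : K, z * σ z = u ∧ Valued.v (z - 1) ≤ Valued.v (u - 1))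
    (hu₀ : Valued.v (u₀ : K) = 1) (hu₁ : Valued.v (u₁ : K) = 1) (hu₂ : Valued.v (u₂ : K) = 1) (hεv : Valued.v (ε : K) = 1)
    (hσu₀ : σ u₀ = u₀) (hσu₁ : σ u₁ = u₁) (hσu₂ : σ u₂ = u₂) (hσε : σ ε = ε) :
    (∀ i, Valued.v ((![((ε : K)) ^ (b.1 : ℕ) * (u₀ : K), (ε : K) ^ (b.2 : ℕ) * (u₁ : K), (ε : K) ^ ((b.1 : ℕ) + (b.2 : ℕ)) * (u₂ : K)] : Fin 3 → K) i) = 1) ∧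
    (∀ i, σ ((![((ε : K)) ^ (b.1 : ℕ) * (u₀ : K), (ε : K) ^ (b.2 : ℕ) * (u₁ : K), (ε : K) ^ ((b.1 : ℕ) + (b.2 : ℕ)) * (u₂ : K)] : Fin 3 → K) i) =
      (![((ε : K)) ^ (b.1 : ℕ) * (u₀ : K), (ε : K) ^ (b.2 : ℕ) * (u₁ : K), (ε : K) ^ ((b.1 : ℕ) + (b.2 : ℕ)) * (u₂ : K)] : Fin 3 → K) i) ∧
    ∃ A : GL (Fin 3) K, IsIntMatrix (A : Matrix (Fin 3) (Fin 3) K) ∧ IsIntMatrix ((A⁻¹ : GL (Fin 3) K) : Matrix (Fin 3) (Fin 3) K) ∧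
      Matrix.diagonal (![((ε : K)) ^ (b.1 : ℕ) * (u₀ : K), (ε : K) ^ (b.2 : ℕ) * (u₁ : K), (ε : K) ^ ((b.1 : ℕ) + (b.2 : ℕ)) * (u₂ : K)] : Fin 3 → K) =
        (-(Matrix.diagonal (![((ε : K)) ^ (b.1 : ℕ) * (u₀ : K), (ε : K) ^ (b.2 : ℕ) * (u₁ : K), (ε : K) ^ ((b.1 : ℕ) + (b.2 : ℕ)) * (u₂ : K)] : Fin 3 → K)).det) •
          formCongr σ A ((StdForm.antidiagonal 3).over K) := by
  have hd := v_literalDiag_eq_one u₀ u₁ u₂ ε b hu₀ hu₁ hu₂ hεv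
  have hdσ := map_literalDiag_eq σ (u₀ : K) (u₁ : K) (u₂ : K) (ε : K) b hσu₀ hσu₁ hσu₂ hσε
  exact ⟨hd, hdσ, exists_glInt_diagonal_eq_smul_formCongr_antidiagonal hσ hvσ hres h2 hnorm _ hd hdσ⟩

end Literal

end Literature.NumberTheory.Automorphic.UnitaryLatticeTree

end
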